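import Summits.AtomisticToContinuum.FouriersLaw.Theorems.OddSectorIrreversibilityTapLeakBoundKickCone

/-!
# `TapLeakBound` (stmt-AtomisticToContinuum-15159), line `SketchIdeator2`, floor of `stub_kickCone`: the bad event

Helper file (`--supports stmt-AtomisticToContinuum-15159`) for crux
P = `Summit.AtomisticToContinuum.FouriersLaw.Theses.OddSectorIrreversibility.TapLeakBound`, registered stub
`stub_kickCone` (C′ `ResampledKickCone`), floor sub-goal F5 `stub_floorBadSplit`. In the floor of the kick cone the space
`PhaseSpace N × ℝ` (phase point `x = (q, p)`, independent `N(0,T)` sample `p'` of the contact momentum `p_b`) carries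
`ν = μ_T ⊗ N(0,T)` (`μ_T = gibbsWeight`, unnormalised, mass `Z`) and is split into a good event `G` and its complement;
off `G` only the a-priori size of the transported observable `g` is used. This file proves that half — pure measure
theory, uniformly in everything:

* `setIntegral_le_sqrt_measureReal_mul_sqrt` — Cauchy–Schwarz on a set: `∫_A H ≤ √(π(A)) · √(∫_A H²)` for
  `0 ≤ H ∈ L²(π)`, `π` finite (Hölder `p = q = 2` against the constant `1` on `π|_A`);
* `setIntegral_resampleDiff_sq_le` — for `g` continuous with `∫ g⁴ dμ_T ≤ M` and `ν(A) ≤ δ`: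
  `∫_A (g(q, p[b ↦ p']) - g(q,p))² dν ≤ 4 √(δ M)` (`(u - v)² ≤ 2u² + 2v²`, Cauchy–Schwarz on `A` for `g²` and
  `g² ∘ σ`, and `∫ g(q, p[b ↦ p'])⁴ dν = ∫ g(q,p)⁴ dν = ∫ g⁴ dμ_T` by the measure-preserving resampling involution
  `S` of `stub_resamplePreserving` and `N(0,T)(ℝ) = 1`);
* `stub_floorBadSplit` — the registered sub-goal, verbatim (`A = Gᶜ`; its `S`-invariance hypothesis on `G` is not
  needed for this half).

References: folklore (Cauchy–Schwarz, Liouville/Gaussian resampling invariance). Nothing here closes the item.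
-/

noncomputable section

open MeasureTheory ProbabilityTheory Filter Topology Set Function
open scoped NNReal ENNReal

namespace Summit.AtomisticToContinuum.FouriersLaw.Theorems.OddSectorIrreversibility.TapLeak

open Literature.MathematicalPhysics.KineticTheory.HeatConduction
open Literature.MathematicalPhysics.KineticTheory
open Summit.AtomisticToContinuum.FouriersLaw.Theorems.OddSectorWitness

/-! ### Cauchy–Schwarz on a set -/

/-- **Cauchy–Schwarz on a set.** For a finite measure `π`, `0 ≤ H ∈ L²(π)` and any set `A`:
`∫_A H dπ ≤ √(π(A)) · √(∫_A H² dπ)` (Hölder with `p = q = 2` for `1 · H` on the restricted measure `π|_A`,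
`Mathlib`'s `integral_mul_le_Lp_mul_Lq_of_nonneg`). [folklore] -/
theorem setIntegral_le_sqrt_measureReal_mul_sqrt {α : Type*} [MeasurableSpace α] {π : Measure α}
    [IsFiniteMeasure π] {H : α → ℝ} (hH0 : ∀ z, 0 ≤ H z) (hH : MemLp H 2 π) (A : Set α) :
    ∫ z in A, H z ∂π ≤ Real.sqrt (π.real A) * Real.sqrt (∫ z in A, H z ^ 2 ∂π) := by
  -- adapted from Literature/Analysis/FluidPDE/AlexakisDoeringInterpolation.lean
  -- (`integral_le_sqrt_integral_mul_integral`, not imported here)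
  have h2 : ENNReal.ofReal (2 : ℝ) = 2 := by simp
  have h1 : MemLp (fun _ : α => (1 : ℝ)) 2 (π.restrict A) := memLp_const 1
  have hH' : MemLp H 2 (π.restrict A) := hH.restrict A
  have hCS := integral_mul_le_Lp_mul_Lq_of_nonneg (μ := π.restrict A) Real.HolderConjugate.two_two
    (ae_of_all _ fun _ => (zero_le_one : (0 : ℝ) ≤ 1)) (ae_of_all _ fun z => hH0 z)
    (by rw [h2]; exact h1) (by rw [h2]; exact hH')
  simp only [one_mul, Real.rpow_two, one_pow, integral_const, smul_eq_mul, mul_one,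
    measureReal_restrict_apply_univ] at hCS
  rw [Real.sqrt_eq_rpow, Real.sqrt_eq_rpow]
  exact hCS

/-! ### The bad event: Cauchy–Schwarz off the good set -/

section BadSplit

variable {ω₂ lam β : ℝ} (hω : 0 < ω₂) (hl : 0 ≤ lam) (hβ : 0 ≤ β) (γ : ℝ) {N : ℕ} {T : ℝ} (hT : 0 < T)
include hω hl hβ hT

/-- **The bad event of the floor of the kick cone.** Let `μ_T = gibbsWeight` (finite), `ν = μ_T ⊗ N(0,T)`, `b` a
coordinate, `g : PhaseSpace N → ℝ` continuous with `∫ g⁴ dμ_T ≤ M`, and `A ⊆ PhaseSpace N × ℝ` with `ν(A) ≤ δ`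
(`0 ≤ δ`). Then `z ↦ (g(q, p[b ↦ p']) - g(q,p))²` is `ν`-integrable on `A` and
`∫_A (g(q, p[b ↦ p']) - g(q,p))² dν ≤ 4 √(δ M)`:
`(u - v)² ≤ 2u² + 2v²`; for `H ∈ {g², g² ∘ σ}` Cauchy–Schwarz on `A` gives
`∫_A H dν ≤ √(ν(A)) √(∫_A H²) ≤ √δ √(∫ H² dν)`, and `∫ H² dν = ∫ g⁴ dμ_T ≤ M` for both (`N(0,T)(ℝ) = 1`; for
`g² ∘ σ = g² ∘ fst ∘ S` by the measure-preserving resampling involution `S` of `stub_resamplePreserving`). [folklore] -/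
theorem setIntegral_resampleDiff_sq_le (b : Fin N) (A : Set (PhaseSpace N × ℝ)) {g : PhaseSpace N → ℝ}
    (hg : Continuous g) (hg4 : Integrable (fun x => g x ^ 4) (gibbsWeight ω₂ lam β γ N T)) {δ M : ℝ}
    (hδ : 0 ≤ δ)
    (hA : ((gibbsWeight ω₂ lam β γ N T).prod (gaussianReal 0 (Real.toNNReal T))) A ≤ ENNReal.ofReal δ)
    (hM : ∫ x, g x ^ 4 ∂(gibbsWeight ω₂ lam β γ N T) ≤ M) :
    IntegrableOn (fun z : PhaseSpace N × ℝ => (g (z.1.1, Function.update z.1.2 b z.2) - g z.1) ^ 2) A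
        ((gibbsWeight ω₂ lam β γ N T).prod (gaussianReal 0 (Real.toNNReal T))) ∧
      ∫ z in A, (g (z.1.1, Function.update z.1.2 b z.2) - g z.1) ^ 2
          ∂((gibbsWeight ω₂ lam β γ N T).prod (gaussianReal 0 (Real.toNNReal T))) ≤
        4 * Real.sqrt (δ * M) := by
  set μ := gibbsWeight ω₂ lam β γ N T with hμ
  set γT : Measure ℝ := gaussianReal 0 (Real.toNNReal T) with hγT
  haveI : IsFiniteMeasure μ := isFiniteMeasure_gibbsWeight hω hl hβ γ N hT
  haveI : IsProbabilityMeasure γT := by rw [hγT]; infer_instance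
  set π : Measure (PhaseSpace N × ℝ) := μ.prod γT with hπ
  set S : PhaseSpace N × ℝ → PhaseSpace N × ℝ :=
    fun z => ((((z.1.1, Function.update z.1.2 b z.2)) : PhaseSpace N), z.1.2 b) with hS
  have hSp : MeasurePreserving S π π := stub_resamplePreserving ω₂ lam β γ hT b
  -- the squared observable `h = g²` and its two lifts `H₁ = h ∘ fst`, `H₂ = h ∘ σ = H₁ ∘ S`
  set h : PhaseSpace N → ℝ := fun x => g x ^ 2 with hh
  have hhc : Continuous h := hg.pow 2
  have hh2 : MemLp h 2 μ := by
    refine (memLp_two_iff_integrable_sq hhc.aestronglyMeasurable).2 ?_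
    refine hg4.congr (Eventually.of_forall fun x => ?_)
    simp only [hh]
    ring
  set H₁ : PhaseSpace N × ℝ → ℝ := fun z => h z.1 with hH₁
  set H₂ : PhaseSpace N × ℝ → ℝ := fun z => h (z.1.1, Function.update z.1.2 b z.2) with hH₂
  have hH12 : MemLp H₁ 2 π := hh2.comp_fst γT
  have hH22 : MemLp H₂ 2 π := memLp_resample ω₂ lam β γ hT b hh2
  have hI1 : Integrable H₁ π := hH12.integrable one_le_two
  have hI2 : Integrable H₂ π := hH22.integrable one_le_two
  have hH10 : ∀ z, 0 ≤ H₁ z := fun z => sq_nonneg _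
  have hH20 : ∀ z, 0 ≤ H₂ z := fun z => sq_nonneg _
  -- fourth moments: `∫ H₁² dπ = ∫ H₂² dπ = ∫ g⁴ dμ`
  have hfst : ∫ z, H₁ z ^ 2 ∂π = ∫ x, g x ^ 4 ∂μ := by
    have e := integral_fun_fst (μ := μ) (ν := γT) (fun x => h x ^ 2)
    rw [probReal_univ, one_smul] at e
    refine e.trans (integral_congr_ae (Eventually.of_forall fun x => ?_))
    simp only [hh]
    ring
  have hsnd : ∫ z, H₂ z ^ 2 ∂π = ∫ x, g x ^ 4 ∂μ := by
    have hm : AEStronglyMeasurable (fun z : PhaseSpace N × ℝ => H₁ z ^ 2) (Measure.map S π) := by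
      rw [hSp.map_eq]
      exact ((hhc.comp continuous_fst).pow 2).aestronglyMeasurable
    have e := integral_map hSp.measurable.aemeasurable hm
    rw [hSp.map_eq] at e
    exact e.symm.trans hfst
  -- Cauchy–Schwarz on `A` for both lifts
  have hπA : π.real A ≤ δ := by
    rw [measureReal_def]
    exact ENNReal.toReal_le_of_le_ofReal hδ hA
  have key : ∀ {H : PhaseSpace N × ℝ → ℝ}, (∀ z, 0 ≤ H z) → MemLp H 2 π →
      ∫ z, H z ^ 2 ∂π = ∫ x, g x ^ 4 ∂μ → ∫ z in A, H z ∂π ≤ Real.sqrt δ * Real.sqrt M := by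
    intro H hH0 hH hH4
    have hle : ∫ z in A, H z ^ 2 ∂π ≤ M := by
      refine (setIntegral_le_integral hH.integrable_sq (Eventually.of_forall fun z => sq_nonneg _)).trans ?_
      rw [hH4]
      exact hM
    calc ∫ z in A, H z ∂π ≤ Real.sqrt (π.real A) * Real.sqrt (∫ z in A, H z ^ 2 ∂π) :=
          setIntegral_le_sqrt_measureReal_mul_sqrt hH0 hH A
      _ ≤ Real.sqrt δ * Real.sqrt M :=
          mul_le_mul (Real.sqrt_le_sqrt hπA) (Real.sqrt_le_sqrt hle) (Real.sqrt_nonneg _)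
            (Real.sqrt_nonneg _)
  have h1 := key hH10 hH12 hfst
  have h2 := key hH20 hH22 hsnd
  -- pointwise `(u - v)² ≤ 2u² + 2v²`, integrability, and the bound
  have hDm : AEStronglyMeasurable
      (fun z : PhaseSpace N × ℝ => (g (z.1.1, Function.update z.1.2 b z.2) - g z.1) ^ 2) π := by
    have hc : Continuous fun z : PhaseSpace N × ℝ => (g (z.1.1, Function.update z.1.2 b z.2) - g z.1) ^ 2 := by
      fun_prop
    exact hc.aestronglyMeasurable
  have hR : Integrable (fun z => 2 * H₂ z + 2 * H₁ z) π := (hI2.const_mul 2).add (hI1.const_mul 2)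
  have hpt : ∀ z : PhaseSpace N × ℝ,
      (g (z.1.1, Function.update z.1.2 b z.2) - g z.1) ^ 2 ≤ 2 * H₂ z + 2 * H₁ z := by
    intro z
    simp only [hH₁, hH₂, hh]
    nlinarith [sq_nonneg (g (z.1.1, Function.update z.1.2 b z.2) + g z.1)]
  have hDI : Integrable
      (fun z : PhaseSpace N × ℝ => (g (z.1.1, Function.update z.1.2 b z.2) - g z.1) ^ 2) π := by
    refine hR.mono' hDm (Eventually.of_forall fun z => ?_)
    rw [Real.norm_of_nonneg (sq_nonneg _)]
    exact hpt z
  refine ⟨hDI.integrableOn, ?_⟩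
  calc ∫ z in A, (g (z.1.1, Function.update z.1.2 b z.2) - g z.1) ^ 2 ∂π
      ≤ ∫ z in A, (2 * H₂ z + 2 * H₁ z) ∂π := setIntegral_mono hDI.integrableOn hR.integrableOn hpt
    _ = 2 * ∫ z in A, H₂ z ∂π + 2 * ∫ z in A, H₁ z ∂π := by
        rw [integral_add (hI2.const_mul 2).integrableOn (hI1.const_mul 2).integrableOn, integral_const_mul,
          integral_const_mul]
    _ ≤ 2 * (Real.sqrt δ * Real.sqrt M) + 2 * (Real.sqrt δ * Real.sqrt M) := by linarith [h1, h2]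
    _ = 4 * Real.sqrt (δ * M) := by
        rw [Real.sqrt_mul hδ]
        ring

end BadSplit

/-! ### The registered sub-goal -/

/-- **Sub-goal `stub_floorBadSplit`** (F5 of the floor of `stub_kickCone`, registered on the crux item
stmt-AtomisticToContinuum-15159, line `SketchIdeator2`): off a measurable good set `G ⊆ PhaseSpace N × ℝ` (invariant under
the resampling involution `S` — a hypothesis of the registered statement that this bound does not use), for `g` continuous
with `g⁴ ∈ L¹(μ_T)`, `(μ_T ⊗ N(0,T))(Gᶜ) ≤ δ` and `∫ g⁴ dμ_T ≤ M`: the squared resampling difference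
`(g(q, p[b ↦ p']) - g(q,p))²` is integrable on `Gᶜ` and `∫_{Gᶜ} (g(q, p[b ↦ p']) - g(q,p))² d(μ_T ⊗ N(0,T)) ≤ 4 √(δ M)`
(`setIntegral_resampleDiff_sq_le` with `A = Gᶜ`). [folklore] -/
theorem stub_floorBadSplit : ∀ (ω₂ lam β γ : ℝ), 0 < ω₂ → 0 ≤ lam → 0 ≤ β → ∀ (N : ℕ) (T : ℝ), 0 < T → ∀ (b : Fin N) (G : Set (PhaseSpace N × ℝ)), MeasurableSet G → (∀ z : PhaseSpace N × ℝ, z ∈ G ↔ ((((z.1.1, Function.update z.1.2 b z.2)) : PhaseSpace N), z.1.2 b) ∈ G) → ∀ (g : PhaseSpace N → ℝ), Continuous g → MeasureTheory.Integrable (fun x => g x ^ 4) (gibbsWeight ω₂ lam β γ N T) → ∀ (δ M : ℝ), 0 ≤ δ → ((gibbsWeight ω₂ lam β γ N T).prod (ProbabilityTheory.gaussianReal 0 (Real.toNNReal T))) Gᶜ ≤ ENNReal.ofReal δ → ∫ x, g x ^ 4 ∂(gibbsWeight ω₂ lam β γ N T) ≤ M → MeasureTheory.IntegrableOn (fun z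 : PhaseSpace N × ℝ => (g (z.1.1, Function.update z.1.2 b z.2) - g z.1) ^ 2) Gᶜ ((gibbsWeight ω₂ lam β γ N T).prod (ProbabilityTheory.gaussianReal 0 (Real.toNNReal T))) ∧ ∫ z in Gᶜ, (g (z.1.1, Function.update z.1.2 b z.2) - g z.1) ^ 2 ∂((gibbsWeight ω₂ lam β γ N T).prod (ProbabilityTheory.gaussianReal 0 (Real.toNNReal T))) ≤ 4 * Real.sqrt (δ * M) := by
  intro ω₂ lam β γ hω hl hβ N T hT b G _hG _hGS g hg hg4 δ M hδ hGc hM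
  exact setIntegral_resampleDiff_sq_le hω hl hβ γ hT b Gᶜ hg hg4 hδ hGc hM

end Summit.AtomisticToContinuum.FouriersLaw.Theorems.OddSectorIrreversibility.TapLeak

end
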